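import Summits.NavierStokesRegularity.OSWSelfSimilar.SheetNSLineTorusCascadeGlobal
import HarnessLib

/-!
# Viscous CLM on the torus (`a = 0`, `σ = 2`): the RECEDING POLE as a SUPER-solution — `c_k(t) ≤ 8ν k (c/(8ν))^k e^{−νkt}`,
# hence `c < 8ν` ⇒ global with the uniform Wiener bound `Σ_k c_k(t) ≤ 64ν² c e^{−νt}/(8ν − c)²`

HONEST FRAMING (cell ns-blowup GROUP B «PROFILE SEARCH», zone Z3, row Z3-U addendum A-F2 of `HOME/profile/z3/CENSUS-Z3.md`;
human rulings D-0035/D-0074; this file is the Z3-TWIN lineage's kernel complement to eng-3's cascade files): **1-D MODEL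
(viscous Constantin–Lax–Majda equation `ω_t = ω Hω + ν ω_xx` on `𝕋`); ODE calculus on Fourier-coefficient families,
kernel-checked; not Euler, not Navier–Stokes; «violates: none — MODEL».**

OBJECT: the sine-datum cascade `IsSineCascade ν c e` of `SheetNSLineTorusCascade` (`ċ_k = ½ Σ_{i+j=k} c_i c_j − ν k² c_k`,
`c_1(0) = c`, `c_k(0) = 0` for `k ≥ 2`). There the periodised Schochet pole `m_k = 24ν k (c/(24ν))^k e^{−νkt}` receding at
speed `ν` was used from BELOW (blow-up for `c ≥ 48ν`), and in `SheetNSLineTorusCascadeGlobal` the `σ = 1` profile from ABOVE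
(global for `c < 2eν ≈ 5.44ν`). HERE the SAME receding pole shape, with the amplitude `24` replaced by `8`, is a SUPER-solution
from `k = 2` on: for `g_k = 8ν k (c/(8ν))^k e^{−νkt}` one has `ġ_k + ν k² g_k = ν (k² − k) g_k` while, by the coefficient
identity `Σ_{i+j=k} i j = (k³ − k)/6` (`SheetNSLineSchochetCornerTorus.torusCorner_coeff_identity` with `12ν′ = 8ν`),
`½ Σ_{i+j=k} g_i g_j = (2ν/3)(k² − 1) g_k ≤ ν (k² − k) g_k` for `k ≥ 2` (`3(k²−k) − 2(k²−1) = (k−1)(k−2) ≥ 0`, equality at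
`k = 2`); and `g_k(0) ≥ 0 = c_k(0)` (`k ≥ 2`), `g_1 = c_1`. Strong
induction (`e^{νk²t}(g_k − c_k)` non-decreasing) gives

* `mode_le_pole8` — **`c_k(t) ≤ 8ν k (c/(8ν))^k e^{−νkt}` for every `k` and `t ≥ 0`** (`ν > 0`, `c ≥ 0`);
* `partialSum_le_of_lt_eight` — **if `c < 8ν` then for all `K`, `t ≥ 0`: `Σ_{k ≤ K} c_k(t) ≤ 64 ν² c e^{−νt}/(8ν − c)²`**
  (from `Σ_k k x^k = x/(1 − x)²`): a uniform, decaying Wiener-norm (`B₀`) bound — the kernel's global-existence constant for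
  sine data moves from `2e ≈ 5.44` to `8` (the located threshold is `19.7756ν`: cascade numerics by two method-disjoint codes,
  eng-3 kit j268783 and eng-5 kit j269975, `HOME/profile/z3twin/runs/Z3-cascade-TWIN_j269975/`).
READING (pen): `8` is what the single receding-pole family gives from `k = 2` on (`12·k/(k+1)` at `k = 2`); the exact receding
solution `q_k e^{−νkt}` (`q_1 = 1`, `(k² − k) q_k = ½ Σ q_i q_j`) would give `R_∞ = 9.3074ν`, and the certified bracket of the
threshold is the certificate lane's business (`HOME/profile/z3twin/`). With the standard `B₀` continuation criterion
[cite: AmbroseLushnikovSiegelSilantyev2024, §3] the bound of `partialSum_le_of_lt_eight` makes the solution from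
`ω₀ = −c sin x`, `c < 8ν`, global and decaying.
bears_on: LADDER-NS N5 / zone Z3 (row Z3-U) → N1 linear core. WHAT THIS IS NOT: not NS; no PDE object constructed; not the
threshold value. No definitions.
-/

namespace Summit.NavierStokesRegularity.OSWSelfSimilar
namespace SheetNSLineTorusCascade

open Finset Real Set

variable {ν c : ℝ} {e : ℕ → ℝ → ℝ}

/-- **Convolution of the amplitude-8 receding pole.** With `g_k = 8ν k r^k`:
`Σ_{i+j=k} g_i g_j = (4ν/3)·(k² − 1)·(8ν k r^k)` — the coefficient identity `Σ_{i+j=k} i j = (k³−k)/6`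
(`SheetNSLineSchochetCornerTorus.torusCorner_coeff_identity` with `ν′ = 2ν/3`, `12ν′ = 8ν`). [new here — MODEL] -/
theorem pole8_conv (ν r : ℝ) (k : ℕ) :
    ∑ p ∈ antidiagonal k, (8 * ν * (p.1 : ℝ) * r ^ p.1) * (8 * ν * (p.2 : ℝ) * r ^ p.2)
      = 4 * ν / 3 * ((k : ℝ) ^ 2 - 1) * (8 * ν * (k : ℝ) * r ^ k) := by
  have key := SheetNSLineSchochetCornerTorus.torusCorner_coeff_identity (2 * ν / 3) r k
  have hrw : ∀ q : ℕ × ℕ, q ∈ antidiagonal k →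
      (8 * ν * (q.1 : ℝ) * r ^ q.1) * (8 * ν * (q.2 : ℝ) * r ^ q.2)
        = (12 * (2 * ν / 3) * (q.1 : ℝ) * r ^ q.1) * (12 * (2 * ν / 3) * (q.2 : ℝ) * r ^ q.2) := by
    intro q _
    ring
  rw [sum_congr rfl hrw]
  have h2 : (12 * (2 * ν / 3) * (k : ℝ) * r ^ k) = 8 * ν * (k : ℝ) * r ^ k := by ring
  rw [h2] at key
  linear_combination (2 : ℝ) * key

/-- **THE RECEDING POLE OF AMPLITUDE 8 IS A SUPER-SOLUTION.** For the sine-datum cascade with `ν > 0`, `c ≥ 0`: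
`c_k(t) ≤ 8ν k (c/(8ν))^k e^{−νkt}` for every `k` and every `t ≥ 0`. Strong induction on the triangular structure:
`e^{νk²t}(g_k − c_k)` is non-decreasing because `½Σ_{i+j=k} g_i g_j = (2ν/3)(k²−1) g_k ≤ ν(k²−k) g_k = ġ_k + νk² g_k`
(`k ≥ 2`),
and it starts at `g_k(0) ≥ 0` (`k ≥ 2`); `k = 1` is the identity `c_1 = c e^{−νt}`, `k = 0` is `0 ≤ 0`. [new here — MODEL] -/
theorem mode_le_pole8 (he : IsSineCascade ν c e) (hν : 0 < ν) (hc : 0 ≤ c) :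
    ∀ k : ℕ, ∀ t : ℝ, 0 ≤ t → e k t ≤ 8 * ν * (k : ℝ) * (c / (8 * ν)) ^ k * exp (-(ν * (k : ℝ) * t)) := by
  intro k
  induction k using Nat.strong_induction_on with
  | _ k ih =>
    intro t ht
    rcases Nat.lt_or_ge k 2 with hk1 | hk2
    · interval_cases k
      · rw [he.zero]; simp
      · rw [mode_one he t ht]
        have hν0 : ν ≠ 0 := hν.ne'
        apply le_of_eq
        field_simp
        ring_nf
    · -- k ≥ 2.  r := c/(8ν) ≥ 0;  A := 8ν k r^k ≥ 0;  B := ν (k² − k) ≥ 0.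
      set r : ℝ := c / (8 * ν) with hr
      have hr0 : 0 ≤ r := div_nonneg hc (by positivity)
      have hk1r : (1 : ℝ) < k := by exact_mod_cast hk2
      have hkk : 0 ≤ (k : ℝ) ^ 2 - k := by nlinarith
      set A : ℝ := 8 * ν * (k : ℝ) * r ^ k with hA
      have hA0 : 0 ≤ A := by rw [hA]; positivity
      set B : ℝ := ν * ((k : ℝ) ^ 2 - k) with hB
      have hB0 : 0 ≤ B := mul_nonneg hν.le hkk
      -- W(s) = e^{νk²s} g_k(s) = A e^{B s};  D(s) = e^{νk²s} e_k(s)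
      set W : ℝ → ℝ := fun s => A * exp (B * s) with hW
      set D : ℝ → ℝ := fun s => exp (ν * (k : ℝ) ^ 2 * s) * e k s with hD
      have hW' : ∀ s, HasDerivAt W (A * (exp (B * s) * B)) s := by
        intro s
        have := ((hasDerivAt_id s).const_mul B).exp
        simp only [id_eq, mul_one] at this
        exact this.const_mul A
      -- the pole values g_j(s) and the identity e^{νk²s} g_k(s) = A e^{Bs}
      have hg_exp : ∀ s : ℝ, exp (ν * (k : ℝ) ^ 2 * s) * (8 * ν * (k : ℝ) * r ^ k * exp (-(ν * (k : ℝ) * s)))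
          = A * exp (B * s) := by
        intro s
        rw [hA, hB]
        have : exp (ν * (k : ℝ) ^ 2 * s) * exp (-(ν * (k : ℝ) * s)) = exp (ν * ((k : ℝ) ^ 2 - k) * s) := by
          rw [← exp_add]; congr 1; ring
        calc exp (ν * (k : ℝ) ^ 2 * s) * (8 * ν * (k : ℝ) * r ^ k * exp (-(ν * (k : ℝ) * s)))
            = 8 * ν * (k : ℝ) * r ^ k * (exp (ν * (k : ℝ) ^ 2 * s) * exp (-(ν * (k : ℝ) * s))) := by ring
          _ = 8 * ν * (k : ℝ) * r ^ k * exp (ν * ((k : ℝ) ^ 2 - k) * s) := by rw [this]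
      -- convolution bound: Σ e_i e_j ≤ Σ g_i g_j = (4ν/3)(k² − 1) g_k
      have hconv : ∀ s, 0 ≤ s →
          ∑ p ∈ antidiagonal k, e p.1 s * e p.2 s
            ≤ 4 * ν / 3 * ((k : ℝ) ^ 2 - 1) * (8 * ν * (k : ℝ) * (r * exp (-(ν * s))) ^ k) := by
        intro s hs
        rw [← pole8_conv ν (r * exp (-(ν * s))) k]
        refine sum_le_sum fun p hp => ?_
        have hsum : p.1 + p.2 = k := mem_antidiagonal.mp hp
        have hgp : ∀ j : ℕ, 8 * ν * (j : ℝ) * (r * exp (-(ν * s))) ^ j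
            = 8 * ν * (j : ℝ) * (c / (8 * ν)) ^ j * exp (-(ν * (j : ℝ) * s)) := by
          intro j
          rw [mul_pow, ← exp_nat_mul, ← hr]
          have : (j : ℝ) * -(ν * s) = -(ν * (j : ℝ) * s) := by ring
          rw [this]; ring
        rcases Nat.eq_zero_or_pos p.1 with h1 | h1
        · rw [h1, he.zero, zero_mul]; simp
        rcases Nat.eq_zero_or_pos p.2 with h2 | h2
        · rw [h2, he.zero, mul_zero]; simp
        have ha := ih p.1 (by omega) s hs
        have hb := ih p.2 (by omega) s hs
        rw [← hgp p.1] at ha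
        rw [← hgp p.2] at hb
        have ha0 : 0 ≤ e p.1 s := nonneg he hc _ s hs
        have hb0 : 0 ≤ e p.2 s := nonneg he hc _ s hs
        exact mul_le_mul ha hb hb0 (le_trans ha0 ha)
      -- ψ = W − D is non-decreasing on [0, ∞)
      have hmono : MonotoneOn (fun s => W s - D s) (Ici 0) := by
        refine monotoneOn_of_hasDerivWithinAt_nonneg
          (f' := fun s => A * (exp (B * s) * B)
            - exp (ν * (k : ℝ) ^ 2 * s) * ((1 / 2) * ∑ p ∈ antidiagonal k, e p.1 s * e p.2 s))
          (convex_Ici 0) ?_ (fun s hs => ?_) (fun s hs => ?_)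
        · refine ContinuousOn.sub (Continuous.continuousOn ?_) (continuousOn_weighted he k)
          exact continuous_const.mul (continuous_exp.comp (continuous_const.mul continuous_id))
        · rw [interior_Ici] at hs ⊢
          exact ((hW' s).sub (hasDerivAt_weighted he k hs)).hasDerivWithinAt
        · rw [interior_Ici] at hs
          have hs0 : 0 ≤ s := le_of_lt hs
          have hE : 0 ≤ exp (ν * (k : ℝ) ^ 2 * s) := (exp_pos _).le
          -- e^{νk²s}·½Σ e e ≤ e^{νk²s}·½·(4ν/3)(k²−1) g_k(s) = (2ν/3)(k²−1)·(A e^{Bs}) ≤ B·(A e^{Bs})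
          have h1 : exp (ν * (k : ℝ) ^ 2 * s) * ((1 / 2) * ∑ p ∈ antidiagonal k, e p.1 s * e p.2 s)
              ≤ exp (ν * (k : ℝ) ^ 2 * s)
                * ((1 / 2) * (4 * ν / 3 * ((k : ℝ) ^ 2 - 1) * (8 * ν * (k : ℝ) * (r * exp (-(ν * s))) ^ k))) :=
            mul_le_mul_of_nonneg_left (mul_le_mul_of_nonneg_left (hconv s hs0) (by norm_num)) hE
          have h2 : exp (ν * (k : ℝ) ^ 2 * s)
                * ((1 / 2) * (4 * ν / 3 * ((k : ℝ) ^ 2 - 1) * (8 * ν * (k : ℝ) * (r * exp (-(ν * s))) ^ k)))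
              = 2 * ν / 3 * ((k : ℝ) ^ 2 - 1) * (A * exp (B * s)) := by
            rw [← hg_exp s]
            have : (r * exp (-(ν * s))) ^ k = r ^ k * exp (-(ν * (k : ℝ) * s)) := by
              rw [mul_pow, ← exp_nat_mul]; congr 1; congr 1; ring
            rw [this]; ring
          have h3 : 2 * ν / 3 * ((k : ℝ) ^ 2 - 1) * (A * exp (B * s)) ≤ A * (exp (B * s) * B) := by
            have hk2r : (2 : ℝ) ≤ k := by exact_mod_cast hk2
            have hfac : 0 ≤ ((k : ℝ) - 1) * ((k : ℝ) - 2) := mul_nonneg (by linarith) (by linarith)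
            have hcoef : 2 * ν / 3 * ((k : ℝ) ^ 2 - 1) ≤ B := by
              rw [hB]; nlinarith [hν.le, hfac]
            have hAe : 0 ≤ A * exp (B * s) := by positivity
            calc 2 * ν / 3 * ((k : ℝ) ^ 2 - 1) * (A * exp (B * s)) ≤ B * (A * exp (B * s)) :=
                  mul_le_mul_of_nonneg_right hcoef hAe
              _ = A * (exp (B * s) * B) := by ring
          linarith
      -- evaluate at 0 and conclude
      have hD0 : D 0 = 0 := by simp [hD, he.init_zero k hk2]
      have hW0 : 0 ≤ W 0 := by simp [hW]; exact hA0
      have hψ := hmono (Set.self_mem_Ici) (show t ∈ Set.Ici (0:ℝ) from ht) ht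
      simp only [hD0, sub_zero] at hψ
      have hWD : D t ≤ W t := by linarith
      have hineq : exp (ν * (k : ℝ) ^ 2 * t) * e k t
          ≤ exp (ν * (k : ℝ) ^ 2 * t) * (8 * ν * (k : ℝ) * r ^ k * exp (-(ν * (k : ℝ) * t))) := by
        rw [hg_exp t]; simpa [hD, hW] using hWD
      exact le_of_mul_le_mul_left hineq (exp_pos _)

/-- **SINE DATA WITH `c < 8ν` ARE GLOBAL, WITH A UNIFORM DECAYING WIENER BOUND.** If `0 ≤ c < 8ν` and `ν > 0` then for every
`K` and `t ≥ 0`: `Σ_{k ≤ K} c_k(t) ≤ 64 ν² c e^{−νt} / (8ν − c)²` (all terms are `≥ 0`, so this bounds the `B₀` norm of every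
Galerkin truncation uniformly in time). Mechanism: `mode_le_pole8` and `Σ_{k} k x^k = x/(1−x)²` at `x = (c/(8ν)) e^{−νt} ≤ c/(8ν) < 1`.
This moves the kernel's global-existence constant for sine data at `σ = 2` from `2e` (`partialSum_le`) to `8`. [new here — MODEL] -/
theorem partialSum_le_of_lt_eight (he : IsSineCascade ν c e) (hν : 0 < ν) (hc : 0 ≤ c) (hsmall : c < 8 * ν)
    (K : ℕ) (t : ℝ) (ht : 0 ≤ t) :
    ∑ k ∈ range (K + 1), e k t ≤ 64 * ν ^ 2 * c * exp (-(ν * t)) / (8 * ν - c) ^ 2 := by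
  set x : ℝ := c / (8 * ν) * exp (-(ν * t)) with hx
  set x₀ : ℝ := c / (8 * ν) with hx₀
  have hx₀0 : 0 ≤ x₀ := div_nonneg hc (by positivity)
  have hx₀1 : x₀ < 1 := by rw [hx₀, div_lt_one (by positivity)]; linarith
  have hexp1 : exp (-(ν * t)) ≤ 1 := by
    rw [exp_le_one_iff]; nlinarith
  have hx0 : 0 ≤ x := by positivity
  have hxx : x ≤ x₀ := by
    rw [hx, hx₀]
    exact mul_le_of_le_one_right hx₀0 hexp1
  have hx1 : x < 1 := lt_of_le_of_lt hxx hx₀1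
  -- termwise: e_k ≤ 8ν k x^k
  have hterm : ∀ k ∈ range (K + 1), e k t ≤ 8 * ν * ((k : ℝ) * x ^ k) := by
    intro k _
    have h := mode_le_pole8 he hν hc k t ht
    have hid : 8 * ν * (k : ℝ) * (c / (8 * ν)) ^ k * exp (-(ν * (k : ℝ) * t)) = 8 * ν * ((k : ℝ) * x ^ k) := by
      rw [hx, mul_pow, ← exp_nat_mul]
      have : (k : ℝ) * -(ν * t) = -(ν * (k : ℝ) * t) := by ring
      rw [this]; ring
    rw [hid] at h
    exact h
  -- Σ_{k ≤ K} k x^k ≤ Σ' k x^k = x/(1−x)²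
  have hnorm : ‖x‖ < 1 := by rw [Real.norm_of_nonneg hx0]; exact hx1
  have hsum : Summable (fun k : ℕ => (k : ℝ) * x ^ k) := by
    have h := summable_pow_mul_geometric_of_norm_lt_one 1 hnorm
    simpa using h
  have hgeom : ∑ k ∈ range (K + 1), (k : ℝ) * x ^ k ≤ x / (1 - x) ^ 2 := by
    rw [← tsum_coe_mul_geometric_of_norm_lt_one hnorm]
    exact hsum.sum_le_tsum (range (K + 1)) (fun k _ => by positivity)
  -- x/(1−x)² ≤ x/(1−x₀)² ≤ x₀ e^{−νt}/(1−x₀)²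
  have h1x : 0 < 1 - x₀ := by linarith
  have hfrac : x / (1 - x) ^ 2 ≤ x / (1 - x₀) ^ 2 := by
    apply div_le_div_of_nonneg_left hx0 (by positivity)
    have : 1 - x₀ ≤ 1 - x := by linarith
    exact pow_le_pow_left₀ h1x.le this 2
  calc ∑ k ∈ range (K + 1), e k t ≤ ∑ k ∈ range (K + 1), 8 * ν * ((k : ℝ) * x ^ k) := sum_le_sum hterm
    _ = 8 * ν * ∑ k ∈ range (K + 1), (k : ℝ) * x ^ k := by rw [mul_sum]
    _ ≤ 8 * ν * (x / (1 - x) ^ 2) := mul_le_mul_of_nonneg_left hgeom (by positivity)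
    _ ≤ 8 * ν * (x / (1 - x₀) ^ 2) := mul_le_mul_of_nonneg_left hfrac (by positivity)
    _ = 64 * ν ^ 2 * c * exp (-(ν * t)) / (8 * ν - c) ^ 2 := by
      rw [hx, hx₀]
      have hν0 : ν ≠ 0 := hν.ne'
      have h8 : 8 * ν - c ≠ 0 := by linarith
      field_simp
      ring

end SheetNSLineTorusCascade
end Summit.NavierStokesRegularity.OSWSelfSimilar
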